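import Mathlib
import Literature.Analysis.Complex.LogSectorExtension
import Literature.Analysis.Complex.PositiveKernelContinuation
import Literature.MathematicalPhysics.QuantumFieldTheory.OSReconstructionNoE1

/-!
# Sketch — first lemmas of the crux-idea cards for `PlanarSpectralCone` (stmt-QuantumFields-9664)

Three signatures, one per card; they need not be proved here, they must elaborate.
-/

noncomputable section

open Complex MeasureTheory Set
open scoped InnerProductSpace ComplexConjugate

namespace Summit.QuantumFields.YangMills.Cruxes.PlanarSpectralCone.Sketch

/-- CARD `lightcone-slots-flat-tube`, first lemma (pure analysis, the `k = 1` instance of the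
tree's log-slot / flat-tube engine WITH the sharp maximum principle): a continuous bounded function
`φ` on the closed quadrant whose two slots are bounded holomorphic functions on the right
half-plane (slot 1: `u ↦ φ(u,u')` for each real `u' ≥ 0`; slot 2: `u' ↦ φ(u,u')` for each real
`u ≥ 0`) extends to a holomorphic function on the sector region `{Re u, Re u' > 0, |arg u| + |arg u'| < π/2}`
bounded by the same constant.  (In the application `φ(u,u') = 𝔖(ΘF* ⊗ G_a)`, `a = u n + u' n'`,
slot 1 = the OS semigroup of the mirror `x₀ = -x₁`, slot 2 = that of `x₀ = x₁`.) -/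
theorem twoSlot_sector_extension_sharp
    (φ : ℝ → ℝ → ℂ) (E₁ E₂ : ℝ → ℂ → ℂ) (M : ℝ)
    (hφc : Continuous (Function.uncurry φ))
    (hφb : ∀ u u' : ℝ, 0 ≤ u → 0 ≤ u' → ‖φ u u'‖ ≤ M)
    (hE₁d : ∀ u' : ℝ, 0 ≤ u' → DifferentiableOn ℂ (E₁ u') {τ : ℂ | 0 < τ.re})
    (hE₂d : ∀ u : ℝ, 0 ≤ u → DifferentiableOn ℂ (E₂ u) {τ : ℂ | 0 < τ.re})
    (hE₁c : ∀ τ : ℂ, 0 < τ.re → Continuous fun u' : ℝ => E₁ u' τ)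
    (hE₂c : ∀ τ : ℂ, 0 < τ.re → Continuous fun u : ℝ => E₂ u τ)
    (hE₁b : ∀ u' : ℝ, 0 ≤ u' → ∀ τ : ℂ, 0 < τ.re → ‖E₁ u' τ‖ ≤ M)
    (hE₂b : ∀ u : ℝ, 0 ≤ u → ∀ τ : ℂ, 0 < τ.re → ‖E₂ u τ‖ ≤ M)
    (hE₁φ : ∀ u' : ℝ, 0 ≤ u' → ∀ x : ℝ, 0 < x → E₁ u' (x : ℂ) = φ x u')
    (hE₂φ : ∀ u : ℝ, 0 ≤ u → ∀ x : ℝ, 0 < x → E₂ u (x : ℂ) = φ u x) :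
    ∃ G : (Fin 2 → ℂ) → ℂ,
      DifferentiableOn ℂ G (Literature.Analysis.Complex.sectorRegion 1 (Real.pi / 2)) ∧
      (∀ u u' : ℝ, 0 < u → 0 < u' → G ![(u : ℂ), (u' : ℂ)] = φ u u') ∧
      ∀ w ∈ Literature.Analysis.Complex.sectorRegion 1 (Real.pi / 2), ‖G w‖ ≤ M := by
  sorry

/-- The Euclidean boost points lie in the two-slot sector region exactly up to the light cone:
for `t > 0`, `σ ∈ ℝ`, the light-cone coordinates `(u,u') = ((t+iσ)/√2, (t-iσ)/√2)` of the
complex translation `(ζ,β) = (t, iσ)` satisfy `|arg u| + |arg u'| < π/2 ↔ |σ| < t` (Thales). -/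
theorem boostPoint_mem_sectorRegion_iff (t σ : ℝ) (ht : 0 < t) :
    (![((t : ℂ) + σ * I) / (Real.sqrt 2 : ℂ), ((t : ℂ) - σ * I) / (Real.sqrt 2 : ℂ)] ∈
        Literature.Analysis.Complex.sectorRegion 1 (Real.pi / 2)) ↔ |σ| < t := by
  sorry

/-- CARD `delayed-cone-spectral-asymptotics`, first lemma (pure measure theory): spectral support
in the light cone is read off from boundedness of the positive Laplace–Fourier transform along
boost rays AFTER AN ARBITRARY DELAY `2 s₀` — a finite measure on energy–momentum space carried by
`{p₀ ≥ 0}` whose exponential moments `∫ e^{-t p₀ + σ p₁} dμ` stay bounded on the delayed cone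
`{|σ| < t - 2s₀}` charges no mass outside `{p₀ ≥ |p₁|}`. -/
theorem measure_cone_compl_eq_zero_of_delayed_ray_bound {d : ℕ} [NeZero d] (hd : 1 < d)
    (μ : Measure (EuclideanSpace ℝ (Fin d))) [IsFiniteMeasure μ]
    (hE : μ {p | p 0 < 0} = 0) (s₀ M : ℝ)
    (hint : ∀ t σ : ℝ, 2 * s₀ < t → |σ| < t - 2 * s₀ →
      Integrable (fun p => Real.exp (-t * p 0 + σ * p ⟨1, hd⟩)) μ)
    (hbd : ∀ t σ : ℝ, 2 * s₀ < t → |σ| < t - 2 * s₀ →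
      ∫ p, Real.exp (-t * p 0 + σ * p ⟨1, hd⟩) ∂μ ≤ M) :
    μ {p | p 0 < |p ⟨1, hd⟩|} = 0 := by
  sorry

/-- CARD `delayed-cone-spectral-asymptotics`, identification lemma (Landau–Pringsheim / Lukacs for
positive-definite functions): if the Fourier transform of a finite positive measure on `ℝ`,
restricted to `(-r, r)`, is the restriction of a function holomorphic on the disc `|β| < r`, then
the measure has all exponential moments of order `< r` (so the transform is holomorphic on the
strip `|Im β| < r` and equals `∫ e^{iβp} dν` there). -/
theorem exp_moments_of_analytic_charFun (ν : Measure ℝ) [IsFiniteMeasure ν] (r : ℝ) (hr : 0 < r)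
    (f : ℂ → ℂ) (hf : DifferentiableOn ℂ f (Metric.ball 0 r))
    (hfν : ∀ b : ℝ, |b| < r → f b = ∫ p, Complex.exp (b * p * I) ∂ν) :
    ∀ σ : ℝ, |σ| < r → Integrable (fun p : ℝ => Real.exp (σ * p)) ν := by
  sorry

/-- CARD `cone-ordered-density-holomorphic-gaps`, first lemma (abstract Hilbert space; the
Kolmogorov/RKHS half of OS II (P_N)): a curve of vectors `v : [0,∞) → H` whose Gram kernel is the
restriction of a kernel `K` on a connected open `U ⊇ [0,∞)` which is positive-semidefinite on `U`,
holomorphic in the second variable and hermitian, is the restriction of a holomorphic `H`-valued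
map on `U` with values in the closed span of the real vectors; hence a vector orthogonal to
`v s` for all large `s` is orthogonal to every `v s`. -/
theorem orthogonal_of_orthogonal_large_gaps
    {H : Type*} [NormedAddCommGroup H] [InnerProductSpace ℂ H] [CompleteSpace H]
    (v : ℝ → H) (U : Set ℂ) (hUo : IsOpen U) (hUc : IsPreconnected U)
    (hU : ∀ s : ℝ, 0 ≤ s → (s : ℂ) ∈ U)
    (K : ℂ → ℂ → ℂ)
    (hKv : ∀ s t : ℝ, 0 ≤ s → 0 ≤ t → K s t = ⟪v s, v t⟫_ℂ)
    (hKpos : Literature.Analysis.Complex.IsPosSemidefKernelOn K U)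
    (hKherm : ∀ w ∈ U, ∀ z ∈ U, K z w = conj (K w z))
    (hKhol : ∀ w ∈ U, DifferentiableOn ℂ (K w) U)
    (hKbd : ∀ z ∈ U, ∃ C : ℝ, ∀ᶠ z' in nhds z, ‖K z' z'‖ ≤ C)
    (χ : H) (s₀ : ℝ) (hχ : ∀ s : ℝ, s₀ ≤ s → ⟪χ, v s⟫_ℂ = 0) :
    ∀ s : ℝ, 0 ≤ s → ⟪χ, v s⟫_ℂ = 0 := by
  sorry

/-- The frame identity (*) in its simplest typed shadow: translation invariance of a one-species
family on `⁰𝒮` passes to every pulled-back family `𝔖 ∘ linActMulti R` (so that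
`OSReconstructionNoE1` applies to each of the eight frames of the crux). -/
theorem isTranslationInvariant_pullback
    (S : Literature.MathematicalPhysics.QuantumLattice.SchwingerFamily (EuclideanSpace ℝ (Fin 4)))
    (htr : ∀ (n : ℕ) (a : EuclideanSpace ℝ (Fin 4))
      (F : SchwartzMap (Fin n → EuclideanSpace ℝ (Fin 4)) ℂ),
      Literature.MathematicalPhysics.AQFT.IsOffDiagonal F →
        S n (Literature.MathematicalPhysics.QuantumLattice.translateMulti a F) = S n F)
    (R : EuclideanSpace ℝ (Fin 4) ≃ₗᵢ[ℝ] EuclideanSpace ℝ (Fin 4)) :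
    (Literature.MathematicalPhysics.QuantumLattice.SchwingerFamily.toLabelled
      (fun n => (S n).comp
        (Literature.MathematicalPhysics.QuantumLattice.linActMulti R))).IsTranslationInvariant := by
  sorry

end Summit.QuantumFields.YangMills.Cruxes.PlanarSpectralCone.Sketch
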